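import Mathlib
import HarnessLib
import Summits.MatrixMultiplication.MatrixMultiplication.Theorems.OutsiderSandwichToricComplement
import Summits.MatrixMultiplication.MatrixMultiplication.Theorems.OutsiderSandwichToricUniqueness
import Summits.MatrixMultiplication.MatrixMultiplication.Theorems.OutsiderSandwichToricCeilingPowSubTwoCrossed
import Summits.MatrixMultiplication.MatrixMultiplication.Theorems.OutsiderSandwichToricCeilingPowSubTwoSpread

/-!
# OutsiderSandwich — no toric `⟨3^N - 2⟩` in the tight frame of `cw₂^{⊠N}`, every `N ≥ 2`:
two perfect matchings of every admissible complement
(decomp-mm lens 4, gen 45, kernel K45; THESES-FREE, `ω`-free; helper toward `LaserTangency`,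
stmt-32268 — the extremal subrank/packing cells of the literal host `kroneckerPow (cwTensor ℂ 2) N`)

LABEL.  TORIC · finite-`N` but UNIFORM IN `N` (a theorem for every `N ≥ 2`, not a census) ·
NEC-side instrument of the decomposition cell; the rates / the crux `h₁ = LaserTangency` and the
route's `closes` are untouched.

WHAT.  `tightFrame_pow_no_diagonal_comb_degeneration_sub_two`: in the TIGHT power frame
`D_N = frame (fun _ => false) ⊂ (Fin N → Fin 3)³` (the support of `cw₂^{⊠N}` in the all-permutation
product basis: a triple `(u, v, w)` belongs to it iff `uᵢ, vᵢ, wᵢ` are pairwise distinct at every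
coordinate) NO diagonal-free `Ψ` with `#Ψ ≥ 3^N - 2` is a combinatorial degeneration
(`a(t.1) + b(t.2.1) + c(t.2.2) = 0` on `Ψ`, `≥ 1` on `D_N ∖ Ψ`), for EVERY `N ≥ 2` and every
linearly ordered commutative ring of weights.  Part 2 (`…ToricCeilingPow`) gave `#Ψ ≤ 3^N - 2`;
this file lowers the tight-frame toric ceiling to `#Ψ ≤ 3^N - 3` for all `N ≥ 2` (the `N = 2`
value `6 = 3² - 3` is attained, `…ToricCeilingTightSeven`/NODE-g44, so the bound is sharp at
`N = 2`; for `N = 3` the exact censuses of NODE-g43 §3 exclude `25, 24, 23` in the tight basis —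
DATA, toric value `∈ [21, 22]` there — so `3^N - 3` is not sharp for `N = 3`).

THE ARGUMENT (perfect-matching reformulation, NODE-g44 §5).  By `…ToricUniqueness`, a
leg-injective degenerating `Ψ` is the UNIQUE diagonal-free perfect matching of `D_N` on its vertex
sets; by `…ToricComplement.tightFrame_two_missing_law`, a `Ψ` with `#Ψ = 3^N - 2` misses two words
per leg, `X = {x₁, x₂}`, `Y = {y₁, y₂}`, `Z = {z₁, z₂}`, and at every coordinate each letter occurs
exactly TWICE among the six missing letters (`twice`).  MAIN LEMMA `hasPM_twoPM`: for every
`N ≥ 1` and EVERY such admissible triple `(X, Y, Z)` the graph `D_N ∖ (X, Y, Z)` has a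
diagonal-free perfect matching, and for `N ≥ 2` two distinct ones — contradiction.  The matchings
are built by induction on `N`, slicing at a pivot coordinate `p` into the three LAYER SLOTS
`(a, a+d, a+2d)` of a primary direction `d ≠ 0` (`glue`, `isPM_glue`: a matching of each slot's
tail instance plus a few AUXILIARY triples of direction `2d` whose tails are removed from the slot
instances), according to the pivot type:
* PURE (`x₁ₚ = x₂ₚ`, `y₁ₚ = y₂ₚ`, hence `z₁ₚ = z₂ₚ`; `twoPM_pure`): slot `a = x₁ₚ` with
  `d = y₁ₚ - a` carries the tail instance (induction), the two other slots are full layers matched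
  by a parallel class `u ↦ (u, u+δ, u+2δ)`; `δ = 1, 2` give two matchings.
* CROSSED (`x₁ₚ = x₂ₚ = a`, `{y₁ₚ, y₂ₚ} = {z₁ₚ, z₂ₚ} = {b, c}`; `crossed_core`, `twoPM_crossedX`):
  `d = b - a`; slot `a` carries the co-size-2 tail instance `({x₁', x₂'}, {y_b', B₁}, {z_c', C₂})`
  (induction), slots `b`, `c` carry STARS `({A₂}, {y_c'}, {C₁})`, `({A₁}, {B₂}, {z_b'})`
  (`isPM_star`: a star's complement is matched by the parallel class of direction `y - x`), and two
  auxiliary triples `(c,b,a)·(A₁,B₁,C₁)`, `(b,a,c)·(A₂,B₂,C₂)` whose tail letters are given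
  coordinatewise by the FLIP RULE `crAux` (`cr_spec`, a finite check over `Fin 3`: rows tight, stars
  tight, the slot-`a` instance admissible, and the flags `B₁ ≠ y_b'`, `C₂ ≠ z_c'` — equality at a
  coordinate would put a letter thrice).  The MIRROR construction (`d = c - a`) is a second matching:
  over the `A`-layer `a` the `B`-letters are `b`, resp. `c`.
* SPREAD (no doubled pair at ANY coordinate; `spread_core`, `twoPM_spread`): the omitted letters
  `ξ, η, ζ` of `X, Y, Z` at the pivot are distinct, `d = η - ξ`; slot `ξ` is a star, slots `η`, `ζ`
  are co-size-2 tail instances (induction), with three auxiliary triples `spT` whose tails are given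
  coordinatewise by the rules `spRule false/true` (`sp_spec`); the second matching uses the other
  rule at ONE tail coordinate, and differs because the auxiliary triples are intrinsic (the triples
  of direction `2d`) and the two rules never agree (`sp_diff`).
The roles of `x, y, z` are rotated (`rot`, `twoPM_rot`, `twice_rot`) so that a doubled pair, if any,
is the `x`-pair (`twoPM_step`); the base `N = 1` is the single triple of omitted letters
(`hasPM_one`).  All letter-level case analyses are `decide`d over `Fin 3` (§5); everything else is
glue bookkeeping on `Fin.insertNth / Fin.removeNth` (`ins`, `tl`, `layer`).

WHY (programme use; critic g20 asks (1)–(4)).  (2) the all-`N` target `(hbig : 3^N ≤ #Ψ + 2) → False`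
asked for "on paper first" is hereby a kernel theorem for the tight basis `κ ≡ false` — the first
toric ceiling of the cell that is uniform in `N` beyond the star argument; (1) no `N = 3` census is
transported or needed; (3) the `N = 3` census data stay DATA (the theorem gives `≤ 24`, the census
`≤ 22`); (4) labelled TORIC/finite-`N`/uniform above.  Mixed bases (`κ` with cw coordinates) are not
treated here: there the letter law is the parity law of `…ToricComplement` and the star slot fails;
that is the next rung.  Parts 1–4 (`…PowSubTwoGlue`, `…Rules`, `…Crossed`, `…Spread`) hold the infrastructure, the local
rules and the slice constructions; this part holds the SPREAD second matching, the pivot rule, the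
base case and the theorem.
-/

set_option linter.dupNamespace false

namespace Summit.MatrixMultiplication.MatrixMultiplication.Theorems.OutsiderSandwichToricCeilingPowSubTwo

open Finset
open Summit.MatrixMultiplication.MatrixMultiplication.Theorems.OutsiderSandwichToricCeiling (dSlot)
open Summit.MatrixMultiplication.MatrixMultiplication.Theorems.OutsiderSandwichToricCeilingPowFibres
  (Word Tr3 slotB frame)
open Summit.MatrixMultiplication.MatrixMultiplication.Theorems.OutsiderSandwichToricCeilingPowSubTwoGlue
open Summit.MatrixMultiplication.MatrixMultiplication.Theorems.OutsiderSandwichToricCeilingPowSubTwoRules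
open Summit.MatrixMultiplication.MatrixMultiplication.Theorems.OutsiderSandwichToricCeilingPowSubTwoCrossed
open Summit.MatrixMultiplication.MatrixMultiplication.Theorems.OutsiderSandwichToricCeilingPowSubTwoSpread
open Summit.MatrixMultiplication.MatrixMultiplication.Theorems.OutsiderSandwichToricCeilingPow
  (productFrame_no_diagonal_comb_degeneration)
open Summit.MatrixMultiplication.MatrixMultiplication.Theorems.OutsiderSandwichToricUniqueness
  (no_comb_degeneration_of_two_matchings)
open Summit.MatrixMultiplication.MatrixMultiplication.Theorems.OutsiderSandwichToricComplement
  (tightFrame_two_missing_law)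

variable {m : ℕ}

/-! ## §6c The SPREAD slice and the pivot rule -/

/-- SPREAD SLICE (no doubled pair anywhere; pivot `0`): the two matchings use the primary rule
everywhere, resp. the alternative rule at the tail coordinate `0`; they differ because their
direction-`2e` triples (the auxiliary ones) would otherwise have equal tails, whereas the two rules
differ at every admissible letter configuration (`sp_diff`). -/
theorem twoPM_spread (ih : ∀ x₁ x₂ y₁ y₂ z₁ z₂ : Word m, x₁ ≠ x₂ → y₁ ≠ y₂ → z₁ ≠ z₂ →
      (∀ i, twice (x₁ i) (x₂ i) (y₁ i) (y₂ i) (z₁ i) (z₂ i) = true) →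
      ∃ P, isPM P {x₁, x₂} {y₁, y₂} {z₁, z₂} = true)
    (hm : 1 ≤ m) {x₁ x₂ y₁ y₂ z₁ z₂ : Word (m + 1)}
    (hadm : ∀ i, twice (x₁ i) (x₂ i) (y₁ i) (y₂ i) (z₁ i) (z₂ i) = true)
    (hsp : ∀ i, x₁ i ≠ x₂ i ∧ y₁ i ≠ y₂ i ∧ z₁ i ≠ z₂ i) :
    ∃ P₁ P₂, P₁ ≠ P₂ ∧ isPM P₁ {x₁, x₂} {y₁, y₂} {z₁, z₂} = true ∧
      isPM P₂ {x₁, x₂} {y₁, y₂} {z₁, z₂} = true := by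
  -- the oriented statement
  have key : ∀ {xe xz yx yz zx ze : Word (m + 1)} (ξ η ζ : Fin 3), ξ ≠ η → η ≠ ζ → ξ ≠ ζ →
      xe 0 = η → xz 0 = ζ → yx 0 = ξ → yz 0 = ζ → zx 0 = ξ → ze 0 = η →
      (∀ i, twice (xe i) (xz i) (yx i) (yz i) (zx i) (ze i) = true) →
      (∀ i, xe i ≠ xz i ∧ yx i ≠ yz i ∧ zx i ≠ ze i) →
      ∃ P₁ P₂, P₁ ≠ P₂ ∧ isPM P₁ {xe, xz} {yx, yz} {zx, ze} = true ∧
        isPM P₂ {xe, xz} {yx, yz} {zx, ze} = true := by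
    intro xe xz yx yz zx ze ξ η ζ d₁ d₂ d₃ hXe hXz hYx hYz hZx hZe hadm hsp
    obtain ⟨he, hη, hζ, -, -, -, -⟩ := F3.spread_dirs ξ η ζ d₁ d₂ d₃
    rw [← hη] at hXe hZe
    rw [← hζ] at hXz hYz
    obtain ⟨P₁, h₁P, hS₁, -⟩ :=
      spread_core ih hm he (fun _ => false) hXe hXz hYx hYz hZx hZe hadm hsp
    obtain ⟨P₂, h₂P, -, hD₂⟩ :=
      spread_core ih hm he (fun j => decide (j = (⟨0, hm⟩ : Fin m))) hXe hXz hYx hYz hZx hZe hadm hsp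
    refine ⟨P₁, P₂, fun heq => ?_, h₁P, h₂P⟩
    obtain ⟨n₁, n₂, n₃⟩ := F3.lift_ne ξ (η - ξ) he
    have M : spT 0 ξ (η - ξ) (fun _ => false) xe xz yx yz zx ze ⊆
        spT 0 ξ (η - ξ) (fun j => decide (j = (⟨0, hm⟩ : Fin m))) xe xz yx yz zx ze := by
      intro t ht
      refine hD₂ t (heq ▸ hS₁ ht) ?_
      simp only [spT, mem_insert, mem_singleton] at ht
      rcases ht with rfl | rfl | rfl <;> simp only [ins_apply_same] <;>
        first | exact (F3.dir2 _ _).1 | exact (F3.dir2 _ _).2.1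
    simp only [spT, insert_subset_iff, singleton_subset_iff, mem_insert, mem_singleton, Prod.mk.injEq,
      ins_inj, n₁, n₂, n₃, n₁.symm, n₂.symm, n₃.symm, true_and, false_and, and_false, or_false,
      false_or] at M
    obtain ⟨⟨eA₁, eB₁, eC₁⟩, ⟨eA₂, eB₂, eC₂⟩, ⟨eA₃, eB₃, eC₃⟩⟩ := M
    refine sp_diff _ _ _ _ _ _ (hadm ((0 : Fin (m + 1)).succAbove ⟨0, hm⟩)) (hsp _).1 (hsp _).2.1
      (hsp _).2.2 ⟨?_, ?_, ?_, ?_, ?_, ?_, ?_, ?_, ?_⟩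
    · simpa using congrFun eA₁ ⟨0, hm⟩
    · simpa using congrFun eB₁ ⟨0, hm⟩
    · simpa using congrFun eC₁ ⟨0, hm⟩
    · simpa using congrFun eA₂ ⟨0, hm⟩
    · simpa using congrFun eB₂ ⟨0, hm⟩
    · simpa using congrFun eC₂ ⟨0, hm⟩
    · simpa using congrFun eA₃ ⟨0, hm⟩
    · simpa using congrFun eB₃ ⟨0, hm⟩
    · simpa using congrFun eC₃ ⟨0, hm⟩
  -- orientation of the three pairs at the pivot `0`
  obtain ⟨hd3, hxo, hyo, hzo⟩ :=
    spread_letters _ _ _ _ _ _ (hadm 0) (hsp 0).1 (hsp 0).2.1 (hsp 0).2.2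
  generalize -(x₁ 0 + x₂ 0) = ξ at hd3 hyo hzo
  generalize -(y₁ 0 + y₂ 0) = η at hd3 hxo hzo
  generalize -(z₁ 0 + z₂ 0) = ζ at hd3 hxo hyo
  obtain ⟨d₁, d₂, d₃⟩ := hd3
  obtain ⟨xe, xz, hX, hXe, hXz, hadm₁, hsp₁⟩ : ∃ xe xz : Word (m + 1),
      ({x₁, x₂} : Finset (Word (m + 1))) = {xe, xz} ∧ xe 0 = η ∧ xz 0 = ζ ∧
      (∀ i, twice (xe i) (xz i) (y₁ i) (y₂ i) (z₁ i) (z₂ i) = true) ∧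
      ∀ i, xe i ≠ xz i ∧ y₁ i ≠ y₂ i ∧ z₁ i ≠ z₂ i := by
    rcases hxo with ⟨e₁, e₂⟩ | ⟨e₁, e₂⟩
    · exact ⟨x₁, x₂, rfl, e₁, e₂, hadm, hsp⟩
    · exact ⟨x₂, x₁, pair_comm _ _, e₁, e₂, fun i => twice_swap_x _ _ _ _ _ _ (hadm i),
        fun i => ⟨(hsp i).1.symm, (hsp i).2⟩⟩
  obtain ⟨yx, yz, hY, hYx, hYz, hadm₂, hsp₂⟩ : ∃ yx yz : Word (m + 1),
      ({y₁, y₂} : Finset (Word (m + 1))) = {yx, yz} ∧ yx 0 = ξ ∧ yz 0 = ζ ∧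
      (∀ i, twice (xe i) (xz i) (yx i) (yz i) (z₁ i) (z₂ i) = true) ∧
      ∀ i, xe i ≠ xz i ∧ yx i ≠ yz i ∧ z₁ i ≠ z₂ i := by
    rcases hyo with ⟨e₁, e₂⟩ | ⟨e₁, e₂⟩
    · exact ⟨y₁, y₂, rfl, e₁, e₂, hadm₁, hsp₁⟩
    · exact ⟨y₂, y₁, pair_comm _ _, e₁, e₂, fun i => twice_swap_y _ _ _ _ _ _ (hadm₁ i),
        fun i => ⟨(hsp₁ i).1, (hsp₁ i).2.1.symm, (hsp₁ i).2.2⟩⟩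
  obtain ⟨zx, ze, hZ, hZx, hZe, hadm₃, hsp₃⟩ : ∃ zx ze : Word (m + 1),
      ({z₁, z₂} : Finset (Word (m + 1))) = {zx, ze} ∧ zx 0 = ξ ∧ ze 0 = η ∧
      (∀ i, twice (xe i) (xz i) (yx i) (yz i) (zx i) (ze i) = true) ∧
      ∀ i, xe i ≠ xz i ∧ yx i ≠ yz i ∧ zx i ≠ ze i := by
    rcases hzo with ⟨e₁, e₂⟩ | ⟨e₁, e₂⟩
    · exact ⟨z₁, z₂, rfl, e₁, e₂, hadm₂, hsp₂⟩
    · exact ⟨z₂, z₁, pair_comm _ _, e₁, e₂, fun i => twice_swap_z _ _ _ _ _ _ (hadm₂ i),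
        fun i => ⟨(hsp₂ i).1, (hsp₂ i).2.1, (hsp₂ i).2.2.symm⟩⟩
  rw [hX, hY, hZ]
  exact key ξ η ζ d₁ d₂ d₃ hXe hXz hYx hYz hZx hZe hadm₃ hsp₃

/-- THE INDUCTION STEP: two distinct diagonal-free perfect matchings of the tight toric frame of
`Word (m+1)` minus any admissible co-size-2 triple (`m ≥ 1`), given one such matching for every
admissible instance over `Word m`.  Pivot rule: slice at a coordinate with a doubled pair if there
is one (PURE / CROSSED, up to rotating the roles of `x, y, z`), else SPREAD. -/
theorem twoPM_step (ih : ∀ x₁ x₂ y₁ y₂ z₁ z₂ : Word m, x₁ ≠ x₂ → y₁ ≠ y₂ → z₁ ≠ z₂ →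
      (∀ i, twice (x₁ i) (x₂ i) (y₁ i) (y₂ i) (z₁ i) (z₂ i) = true) →
      ∃ P, isPM P {x₁, x₂} {y₁, y₂} {z₁, z₂} = true)
    (hm : 1 ≤ m) {x₁ x₂ y₁ y₂ z₁ z₂ : Word (m + 1)} (hx : x₁ ≠ x₂) (hy : y₁ ≠ y₂) (hz : z₁ ≠ z₂)
    (hadm : ∀ i, twice (x₁ i) (x₂ i) (y₁ i) (y₂ i) (z₁ i) (z₂ i) = true) :
    ∃ P₁ P₂, P₁ ≠ P₂ ∧ isPM P₁ {x₁, x₂} {y₁, y₂} {z₁, z₂} = true ∧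
      isPM P₂ {x₁, x₂} {y₁, y₂} {z₁, z₂} = true := by
  by_cases hX : ∃ p, x₁ p = x₂ p
  · obtain ⟨p, hxp⟩ := hX
    by_cases hyp : y₁ p = y₂ p
    · exact twoPM_pure ih hm hx hy hz hadm hxp hyp
    · exact twoPM_crossedX ih hm hx hadm hxp hyp
  by_cases hY : ∃ p, y₁ p = y₂ p
  · obtain ⟨p, hyp⟩ := hY
    have hadm' : ∀ i, twice (y₁ i) (y₂ i) (z₁ i) (z₂ i) (x₁ i) (x₂ i) = true :=
      fun i => twice_rot _ _ _ _ _ _ (hadm i)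
    have two : ∃ P₁ P₂, P₁ ≠ P₂ ∧ isPM P₁ {y₁, y₂} {z₁, z₂} {x₁, x₂} = true ∧
        isPM P₂ {y₁, y₂} {z₁, z₂} {x₁, x₂} = true := by
      by_cases hzp : z₁ p = z₂ p
      · exact twoPM_pure ih hm hy hz hx hadm' hyp hzp
      · exact twoPM_crossedX ih hm hy hadm' hyp hzp
    exact twoPM_rot (twoPM_rot two)
  by_cases hZ : ∃ p, z₁ p = z₂ p
  · obtain ⟨p, hzp⟩ := hZ
    have hadm' : ∀ i, twice (z₁ i) (z₂ i) (x₁ i) (x₂ i) (y₁ i) (y₂ i) = true :=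
      fun i => twice_rot _ _ _ _ _ _ (twice_rot _ _ _ _ _ _ (hadm i))
    have hxp : x₁ p ≠ x₂ p := fun h => hX ⟨p, h⟩
    exact twoPM_rot (twoPM_crossedX ih hm hz hadm' hzp hxp)
  push Not at hX hY hZ
  exact twoPM_spread ih hm hadm fun i => ⟨hX i, hY i, hZ i⟩

/-! ## §7 The base case `N = 1` and the induction -/

/-- Words of length one are equal iff their letters at `0` are. -/
theorem word_one_eq {u v : Word 1} (h : u 0 = v 0) : u = v :=
  funext fun i => by rw [Subsingleton.elim i 0]; exact h

/-- In `Word 1`, the constant word on the letter avoided by two distinct words is their complement. -/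
theorem word_one_compl (α β γ : Fin 3) (w₁ w₂ : Word 1) (hd : α ≠ β ∧ β ≠ γ ∧ α ≠ γ)
    (ho : (w₁ 0 = β ∧ w₂ 0 = γ) ∨ (w₂ 0 = β ∧ w₁ 0 = γ)) :
    ({(fun _ => α : Word 1)} : Finset (Word 1)) = univ \ {w₁, w₂} := by
  obtain ⟨d₁, d₂, d₃⟩ := hd
  ext u
  simp only [mem_singleton, mem_sdiff, mem_univ, true_and, mem_insert, not_or]
  constructor
  · rintro rfl
    rcases ho with ⟨e₁, e₂⟩ | ⟨e₁, e₂⟩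
    · exact ⟨fun h => d₁ ((congrFun h 0).trans e₁), fun h => d₃ ((congrFun h 0).trans e₂)⟩
    · exact ⟨fun h => d₃ ((congrFun h 0).trans e₂), fun h => d₁ ((congrFun h 0).trans e₁)⟩
  · rintro ⟨h₁, h₂⟩
    rcases F3.cover α β γ (u 0) d₁ d₂ d₃ with hu | hu | hu
    · exact word_one_eq hu
    · rcases ho with ⟨e₁, e₂⟩ | ⟨e₁, e₂⟩
      · exact absurd (word_one_eq (hu.trans e₁.symm)) h₁
      · exact absurd (word_one_eq (hu.trans e₁.symm)) h₂
    · rcases ho with ⟨e₁, e₂⟩ | ⟨e₁, e₂⟩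
      · exact absurd (word_one_eq (hu.trans e₂.symm)) h₂
      · exact absurd (word_one_eq (hu.trans e₂.symm)) h₁

/-- BASE CASE `N = 1`: the one-triple matching `(ξ, η, ζ)` of the omitted letters. -/
theorem hasPM_one (x₁ x₂ y₁ y₂ z₁ z₂ : Word 1) (hx : x₁ ≠ x₂) (hy : y₁ ≠ y₂) (hz : z₁ ≠ z₂)
    (hadm : ∀ i, twice (x₁ i) (x₂ i) (y₁ i) (y₂ i) (z₁ i) (z₂ i) = true) :
    ∃ P, isPM P {x₁, x₂} {y₁, y₂} {z₁, z₂} = true := by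
  have hx0 : x₁ 0 ≠ x₂ 0 := fun h => hx (word_one_eq h)
  have hy0 : y₁ 0 ≠ y₂ 0 := fun h => hy (word_one_eq h)
  have hz0 : z₁ 0 ≠ z₂ 0 := fun h => hz (word_one_eq h)
  obtain ⟨hd3, hxo, hyo, hzo⟩ := spread_letters _ _ _ _ _ _ (hadm 0) hx0 hy0 hz0
  generalize -(x₁ 0 + x₂ 0) = ξ at hd3 hyo hzo
  generalize -(y₁ 0 + y₂ 0) = η at hd3 hxo hzo
  generalize -(z₁ 0 + z₂ 0) = ζ at hd3 hxo hyo
  obtain ⟨d₁, d₂, d₃⟩ := hd3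
  refine ⟨{((fun _ => ξ), (fun _ => η), (fun _ => ζ))}, isPM_iff.2 ⟨?_, by simp, by simp, by simp,
    ?_, ?_, ?_⟩⟩
  · intro t ht
    rw [mem_singleton] at ht
    subst ht
    exact mem_tfr.2 fun _ => ⟨d₁, d₂, d₃⟩
  · rw [image_singleton]; exact word_one_compl ξ η ζ x₁ x₂ ⟨d₁, d₂, d₃⟩ hxo
  · rw [image_singleton]; exact word_one_compl η ξ ζ y₁ y₂ ⟨d₁.symm, d₃, d₂⟩ hyo
  · rw [image_singleton]; exact word_one_compl ζ ξ η z₁ z₂ ⟨d₃.symm, d₁, d₂.symm⟩ hzo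

/-- MAIN LEMMA (all `N ≥ 1`, resp. `N ≥ 2`): the tight toric frame of `Word N` minus ANY
admissible co-size-2 triple has a diagonal-free perfect matching, and for `N ≥ 2` two distinct
ones. -/
theorem hasPM_twoPM : ∀ m, 1 ≤ m →
    (∀ x₁ x₂ y₁ y₂ z₁ z₂ : Word m, x₁ ≠ x₂ → y₁ ≠ y₂ → z₁ ≠ z₂ →
      (∀ i, twice (x₁ i) (x₂ i) (y₁ i) (y₂ i) (z₁ i) (z₂ i) = true) →
      ∃ P, isPM P {x₁, x₂} {y₁, y₂} {z₁, z₂} = true) ∧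
    (2 ≤ m → ∀ x₁ x₂ y₁ y₂ z₁ z₂ : Word m, x₁ ≠ x₂ → y₁ ≠ y₂ → z₁ ≠ z₂ →
      (∀ i, twice (x₁ i) (x₂ i) (y₁ i) (y₂ i) (z₁ i) (z₂ i) = true) →
      ∃ P₁ P₂, P₁ ≠ P₂ ∧ isPM P₁ {x₁, x₂} {y₁, y₂} {z₁, z₂} = true ∧
        isPM P₂ {x₁, x₂} {y₁, y₂} {z₁, z₂} = true) := by
  intro m hm
  induction m, hm using Nat.le_induction with
  | base => exact ⟨hasPM_one, fun h => absurd h (by norm_num)⟩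
  | succ m hm IH =>
    refine ⟨fun x₁ x₂ y₁ y₂ z₁ z₂ hx hy hz hadm => ?_, fun _ x₁ x₂ y₁ y₂ z₁ z₂ hx hy hz hadm =>
      twoPM_step IH.1 hm hx hy hz hadm⟩
    obtain ⟨P₁, -, -, h₁, -⟩ := twoPM_step IH.1 hm hx hy hz hadm
    exact ⟨P₁, h₁⟩

/-! ## §8 The theorem -/

/-- **Toric ceiling `⟨3^N - 2⟩`, all `N ≥ 2`.**  In the tight power frame `D_N ⊂ (Fin N → Fin 3)³`
(a permutation in every coordinate) no diagonal-free `Ψ` with `#Ψ ≥ 3^N - 2` is a combinatorial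
degeneration: `#Ψ ≥ 3^N - 1` is `…ToricCeilingPow.productFrame_no_diagonal_comb_degeneration`;
for `#Ψ = 3^N - 2` the missing words obey the letter law
(`…ToricComplement.tightFrame_two_missing_law`), the complement then carries two distinct
diagonal-free perfect matchings (`hasPM_twoPM`), and two perfect matchings with the same vertex
sets exclude a degeneration (`…ToricUniqueness.no_comb_degeneration_of_two_matchings`).
[TORIC · finite-N for every N · NEC-side instrument; the rates of `h₁ = LaserTangency` untouched] -/
theorem tightFrame_pow_no_diagonal_comb_degeneration_sub_two {R : Type*} [CommRing R]
    [LinearOrder R] [IsStrictOrderedRing R] {N : ℕ} (hN : 2 ≤ N) {Ψ : Finset (Tr3 N)}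
    {a b c : Word N → R} (hsub : Ψ ⊆ frame (fun _ : Fin N => false))
    (hzero : ∀ t ∈ Ψ, a t.1 + b t.2.1 + c t.2.2 = 0)
    (hone : ∀ t ∈ frame (fun _ : Fin N => false), t ∉ Ψ → 1 ≤ a t.1 + b t.2.1 + c t.2.2)
    (hdiag : ∀ t ∈ Ψ, ∀ t' ∈ Ψ, (t.1 = t'.1 ∨ t.2.1 = t'.2.1 ∨ t.2.2 = t'.2.2) → t = t')
    (hbig : 3 ^ N ≤ #Ψ + 2) : False := by
  by_cases h1 : 3 ^ N ≤ #Ψ + 1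
  · exact productFrame_no_diagonal_comb_degeneration hN (fun _ => false) hsub hzero hone hdiag h1
  have hcard : #Ψ + 2 = 3 ^ N := by omega
  obtain ⟨x₁, x₂, y₁, y₂, z₁, z₂, hx, hy, hz, hX, hY, hZ, hlaw⟩ :=
    tightFrame_two_missing_law hsub hdiag hcard
  obtain ⟨P₁, P₂, hne, h₁, h₂⟩ := (hasPM_twoPM N (by omega)).2 hN x₁ x₂ y₁ y₂ z₁ z₂ hx hy hz
    (fun i => twice_iff.2 (hlaw i))
  obtain ⟨f₁, j₁₁, j₁₂, j₁₃, i₁₁, i₁₂, i₁₃⟩ := isPM_iff.1 h₁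
  obtain ⟨f₂, j₂₁, j₂₂, j₂₃, i₂₁, i₂₂, i₂₃⟩ := isPM_iff.1 h₂
  have jΨ₁ : Set.InjOn (fun t : Tr3 N => t.1) Ψ := fun t ht t' ht' e => hdiag t ht t' ht' (Or.inl e)
  have jΨ₂ : Set.InjOn (fun t : Tr3 N => t.2.1) Ψ :=
    fun t ht t' ht' e => hdiag t ht t' ht' (Or.inr (Or.inl e))
  have jΨ₃ : Set.InjOn (fun t : Tr3 N => t.2.2) Ψ :=
    fun t ht t' ht' e => hdiag t ht t' ht' (Or.inr (Or.inr e))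
  exact no_comb_degeneration_of_two_matchings hne f₁ f₂ j₁₁ j₁₂ j₁₃ j₂₁ j₂₂ j₂₃
    (i₁₁.trans i₂₁.symm) (i₁₂.trans i₂₂.symm) (i₁₃.trans i₂₃.symm)
    ⟨Ψ, a, b, c, hzero, hone, jΨ₁, jΨ₂, jΨ₃, hX.trans i₁₁.symm, hY.trans i₁₂.symm,
      hZ.trans i₁₃.symm⟩

end Summit.MatrixMultiplication.MatrixMultiplication.Theorems.OutsiderSandwichToricCeilingPowSubTwo
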